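import Summits.AtomisticToContinuum.Crystallization.Theorems.FrustratedLawDichotomyAtlasDoorPull
import Summits.AtomisticToContinuum.Crystallization.Theorems.FrustratedLawDichotomyCoherentOn
import Summits.AtomisticToContinuum.Crystallization.Theorems.FrustratedLawDichotomySignedLedgerHardCoreClass

/-!
# FrustratedLawDichotomy · crux `AperiodicFrustratedLawGap` (stmt-AtomisticToContinuum-27623) — «ZoneKernel»: THE HOST-LIKE MARK OF RECORD
# (ZONE-TRANSPORT, lens-5 SPEC §1 (K1)–(K4) / ZROW-FLOOR-g114 (Z0) design constraint D1 / critic r1848 (C), r1852 (B), r1855 (A); decomp-a2c hand-2 g48)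

The cell-free pull kernel of (329) `…PullKernel` is parametrised by an abstract mark `Hm : Measure E3 → E3 → Prop` with two obligations:
joint measurability `MeasurableSet {p | Hm p.1 p.2}` (door clause, (334) `aperiodicFrustratedLawGap_of_atlasPull`) and exact covariance
`Hm (θ_y μ) z ↔ Hm μ (z + y)` for EVERY measure `μ` ((K1)/(K2) `floor_add_net_of_floor`, hand-1 (335′) `…ZoneFloor.floor_transport_of_zoneFloor₁/₂`).
This file supplies THE MARK, generically in a countable TEMPLATE ATLAS `𝓐 ⊆ Finset E3 × Set E3` of (half-ball pattern, window) pairs: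

  `HostLikeAt δ τ 𝓐 μ y :⇔ IsRootedHardCore δ (θ_y μ) ∧ ∃ (a, W) ∈ 𝓐, θ_y μ ∈ coherentOn a τ W`     (`θ_y μ = μ.map (· − y)`)

«re-rooted at the atom `y`, the configuration is `τ`-coherent with some atlas pattern on its window» (SPEC §1: radius-`R_A′` half-ball patterns of the
host templates with their closed strain boxes, any rational rotation / normal — the atlas is DATA of the registry file; every lemma here holds for
any countable `𝓐` with measurable windows, so hosts can be added without touching this file, `HostLikeAt.mono`).

* §1 ★ `hostLikeAt_shift` — EXACT covariance for all `μ` (no hard-core hypothesis: `θ_z θ_y = θ_{z+y}` on measures, `map_sub_map_sub`);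
  `hostLikeAt_zero_iff`; `HostLikeAt.apply_singleton_ne_zero` (marked points are atoms); `hostLikeAt_iff_of_atom`.
* §2 ★★ `measurableSet_hostLikeAt` — JOINT measurability in `(μ, y)` over ALL measures (the only real work, SPEC (K4)): the rooted-hard-core guard puts
  `μ` in the ROOT-FREE hard-core class (the ball condition of TREE `…SignedLedgerHardCoreClass`, translation invariant and Giry-measurable —
  `ballCondition_of_isRootedHardCore_map_sub`), on which the s-finite truncated identity kernel `κ` of TREE `…FiniteClusterGapPrelude`
  (`exists_kernel_eq_count_restrict`) is the identity, so `{Hm} = (ball class × E3) ∩ Ψ⁻¹ C` with `Ψ (μ, y) = θ_y (κ μ)` jointly measurable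
  (`measurable_kernel_map_sub`) and `C = {rooted δ-hard-core} ∩ ⋃_𝓐 coherentOn` measurable (`BenjaminiSchrammLimit.measurableSet_setOf_isRootedHardCore`,
  `measurableSet_coherentOn`).  (Without the guard the statement is false: `{(μ, y) | μ {y} ≠ 0}` has the non-measurable section `N` at `μ = count⌊N`.)
* §3 ★ (Z0)/(K1 input) `hostLikeAt_zero_of_coherentOn` — THE ROOT OF A COHERENT CELL MEMBER IS HOST-LIKE, via `coherentOn_restrict` (coherence passes to a
  sub-pattern on a sub-window when the dropped sites' balls miss the sub-window): the bridge every class-A/H/Z K-file uses for `h0`.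
* §4 the D-FACING cell clause `DFacing δ Hm R n s = {μ rooted δ-hard-core | μ {q | ‖q‖ ≤ R ∧ s < ⟪q, n⟫ ∧ Hm μ q} = 0}` for ANY jointly measurable mark:
  ★ `measurableSet_dFacing` (section measure of the truncated identity kernel, `Kernel.measurable_kernel_prodMk_left`) and `dFacing_pointwise` /
  `mem_dFacing_of_pointwise` = the plane form `∀ q, μ {q} ≠ 0 → ‖q‖ ≤ R → s < ⟪q, n⟫ → ¬ Hm μ q` that hand-1's `zoneFloor₁` consumes (`hD`).
* §5 the programme's top line with the mark plugged in: `measurable_zonePull_hostLikeAt`, `floor_add_net_hostLike_of_floor` ((K2) for A/H rows),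
  ★ `aperiodicFrustratedLawGap_of_hostLikeAtlas` = (334) at `Hm := HostLikeAt δ τ 𝓐` — remaining hypotheses: the row list with transported floors and
  `ResidualCoreDeficitT n K mK 0 (zonePull (HostLikeAt δ τ 𝓐) 8)`.
Imports: TREE (334) `…AtlasDoorPull`, `…CoherentOn`, `…SignedLedgerHardCoreClass` (all inside the FrustratedLawDichotomy cone; no other route file);
2 defs (`HostLikeAt`, `DFacing`) + 1 auxiliary def (`dZone`); 0 sorry.  Tags: [folklore: measure theory / bookkeeping]; nothing here closes an item.
-/

noncomputable section

namespace Summit.AtomisticToContinuum.Crystallization.Theorems.FrustratedLawDichotomyZoneKernel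

open MeasureTheory Metric Set Filter RealInnerProductSpace ProbabilityTheory TopologicalSpace
open scoped ENNReal Topology BigOperators
open Literature.MathematicalPhysics.StatisticalMechanics (rootEnergy lennardJones)
open Literature.Probability.Process (IsRootedHardCore map_sub_count_restrict count_restrict_singleton_ne_zero_iff)
open Literature.Probability.Process.LocalConfig (isClosed_of_separated)
open Summit.AtomisticToContinuum.Crystallization.Theorems.ChargedEnergyGapNegative (E3)
open Summit.AtomisticToContinuum.Crystallization.Theorems.FrustratedLawDichotomySignedLedger (net)
open Summit.AtomisticToContinuum.Crystallization.Theorems.FrustratedLawDichotomyCoherentOn (coherentOn mem_coherentOn_iff measurableSet_coherentOn)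
open Summit.AtomisticToContinuum.Crystallization.Theorems.FrustratedLawDichotomyPullKernel
  (zonePull measurable_zonePull floor_add_net_of_floor floor_add_net_of_floor_outflow)
open Summit.AtomisticToContinuum.Crystallization.Theorems.FrustratedLawDichotomyAtlasDoorTransport (ResidualCoreDeficitT)
open Summit.AtomisticToContinuum.Crystallization.Theorems.FrustratedLawDichotomyAtlasDoorPull (aperiodicFrustratedLawGap_of_atlasPull)
open Summit.AtomisticToContinuum.Crystallization.Theorems.FrustratedLawDichotomyFiniteClusterGap (exists_kernel_eq_count_restrict measurable_kernel_map_sub)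
open Summit.AtomisticToContinuum.Crystallization.Theorems.FrustratedLawDichotomySignedLedgerHardCoreClass
  (measurableSet_setOf_ballCondition ballCondition_of_isRootedHardCore ballCondition_map_sub_iff ballCondition_iff_exists_count_restrict)
open Summit.AtomisticToContinuum.Crystallization.Theorems.BenjaminiSchrammLimit (measurableSet_setOf_isRootedHardCore)

variable {δ τ : ℝ} {𝓐 𝓑 : Set (Finset E3 × Set E3)} {μ : Measure E3} {y : E3}

/-! ## §1. The mark and its covariance -/

/-- ★ **THE HOST-LIKE MARK.**  `HostLikeAt δ τ 𝓐 μ y`: re-rooted at `y`, `μ` is a rooted `δ`-hard-core configuration which is `τ`-coherent with some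
atlas entry `(a, W) ∈ 𝓐` — every template ball `closedBall x τ`, `x ∈ a`, carries an atom and the window `W` carries no atom outside the template balls. -/
def HostLikeAt (δ τ : ℝ) (𝓐 : Set (Finset E3 × Set E3)) (μ : Measure E3) (y : E3) : Prop :=
  IsRootedHardCore δ (μ.map fun x => x - y) ∧ ∃ p ∈ 𝓐, μ.map (fun x => x - y) ∈ coherentOn p.1 τ p.2

/-- Re-rooting twice is re-rooting once: `θ_z (θ_y μ) = θ_{z+y} μ`, for EVERY measure. [folklore] -/
theorem map_sub_map_sub (μ : Measure E3) (y z : E3) : (μ.map fun x => x - y).map (fun x => x - z) = μ.map fun x => x - (z + y) := by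
  rw [Measure.map_map (measurable_sub_const z) (measurable_sub_const y)]
  congr 1
  funext x
  show x - y - z = x - (z + y)
  abel

/-- Re-rooting at the root does nothing. [folklore] -/
theorem map_sub_zero (μ : Measure E3) : μ.map (fun x : E3 => x - 0) = μ := by
  simp only [sub_zero, Measure.map_id']

/-- ★ **EXACT COVARIANCE** of the mark (the `hshift` of (329) `…PullKernel`), for every measure `μ`. [folklore] -/
theorem hostLikeAt_shift (μ : Measure E3) (y z : E3) : HostLikeAt δ τ 𝓐 (μ.map fun x => x - y) z ↔ HostLikeAt δ τ 𝓐 μ (z + y) := by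
  simp only [HostLikeAt, map_sub_map_sub]

/-- The covariance in the packaged form the (329)/(335′) lemmas take. [folklore] -/
theorem hostLikeAt_hshift (δ τ : ℝ) (𝓐 : Set (Finset E3 × Set E3)) :
    ∀ (μ : Measure E3) (y z : E3), HostLikeAt δ τ 𝓐 (μ.map fun x => x - y) z ↔ HostLikeAt δ τ 𝓐 μ (z + y) :=
  hostLikeAt_shift

/-- The mark at the root: hard core plus coherence with an atlas entry. [folklore] -/
theorem hostLikeAt_zero_iff (μ : Measure E3) : HostLikeAt δ τ 𝓐 μ 0 ↔ IsRootedHardCore δ μ ∧ ∃ p ∈ 𝓐, μ ∈ coherentOn p.1 τ p.2 := by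
  simp only [HostLikeAt, map_sub_zero]

/-- The atlas is monotone data: entries can be added without losing marks. [folklore] -/
theorem HostLikeAt.mono (h : HostLikeAt δ τ 𝓐 μ y) (h𝓐 : 𝓐 ⊆ 𝓑) : HostLikeAt δ τ 𝓑 μ y :=
  ⟨h.1, by obtain ⟨p, hp, hc⟩ := h.2; exact ⟨p, h𝓐 hp, hc⟩⟩

/-- A marked point is hard-core when viewed from it. -/
theorem HostLikeAt.isRootedHardCore (h : HostLikeAt δ τ 𝓐 μ y) : IsRootedHardCore δ (μ.map fun x => x - y) := h.1

/-- The re-rooted mass of the root is the mass of the new root point. [folklore] -/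
theorem map_sub_apply_singleton_zero (μ : Measure E3) (y : E3) : (μ.map fun x => x - y) {0} = μ {y} := by
  rw [Measure.map_apply (measurable_sub_const y) (measurableSet_singleton 0)]
  congr 1
  ext x
  simp only [mem_preimage, mem_singleton_iff, sub_eq_zero]

/-- ★ Marked points are ATOMS. [folklore] -/
theorem HostLikeAt.apply_singleton_ne_zero (h : HostLikeAt δ τ 𝓐 μ y) : μ {y} ≠ 0 := by
  obtain ⟨S, h0S, -, hS⟩ := h.1
  rw [← map_sub_apply_singleton_zero, hS]
  exact (count_restrict_singleton_ne_zero_iff S 0).mpr h0S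

/-- At an atom of a rooted hard-core configuration the guard is automatic: the mark is coherence of the re-rooted configuration. [folklore] -/
theorem hostLikeAt_iff_of_atom (hμ : IsRootedHardCore δ μ) (hy : μ {y} ≠ 0) :
    HostLikeAt δ τ 𝓐 μ y ↔ ∃ p ∈ 𝓐, μ.map (fun x => x - y) ∈ coherentOn p.1 τ p.2 :=
  ⟨fun h => h.2, fun h => ⟨hμ.map_sub hy, h⟩⟩

/-! ## §2. Joint measurability -/

/-- If `μ` re-rooted somewhere is rooted `δ`-hard-core then `μ` itself satisfies the (translation-invariant) BALL CONDITION of the root-free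
hard-core class. [folklore] -/
theorem ballCondition_of_isRootedHardCore_map_sub {μ : Measure E3} {y : E3} (h : IsRootedHardCore δ (μ.map fun x => x - y)) :
    ∀ n : ℕ, ∀ q : ℚ, (q : ℝ) < δ / 2 → μ (ball (denseSeq E3 n) q) = 0 ∨ μ (ball (denseSeq E3 n) q) = 1 :=
  (ballCondition_map_sub_iff δ μ y).mp (ballCondition_of_isRootedHardCore h)

/-- … hence `μ` IS the counting measure of a `δ`-separated set (`δ > 0`). [folklore] -/
theorem exists_eq_count_restrict_of_isRootedHardCore_map_sub (hδ : 0 < δ) {μ : Measure E3} {y : E3}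
    (h : IsRootedHardCore δ (μ.map fun x => x - y)) :
    ∃ S : Set E3, (∀ x ∈ S, ∀ x' ∈ S, x ≠ x' → δ ≤ dist x x') ∧ μ = (Measure.count : Measure E3).restrict S :=
  (ballCondition_iff_exists_count_restrict hδ μ).mp (ballCondition_of_isRootedHardCore_map_sub h)

/-- The target set of the re-rooting map: rooted hard core and coherence with some atlas entry; measurable for a countable atlas with measurable windows. -/
theorem measurableSet_target (hδ : 0 < δ) (h𝓐 : 𝓐.Countable) (hW : ∀ p ∈ 𝓐, MeasurableSet p.2) :
    MeasurableSet ({ν : Measure E3 | IsRootedHardCore δ ν} ∩ ⋃ p ∈ 𝓐, coherentOn p.1 τ p.2) :=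
  (measurableSet_setOf_isRootedHardCore hδ).inter (MeasurableSet.biUnion h𝓐 fun p hp => measurableSet_coherentOn p.1 τ (hW p hp))

/-- The mark as a preimage under a TRUNCATED re-rooting map `(μ, y) ↦ θ_y (κ μ)` (any `κ` fixing the counting measures of `δ`-separated sets),
guarded by the ball condition. [folklore] -/
theorem setOf_hostLikeAt_eq (hδ : 0 < δ) (κ : Kernel (Measure E3) E3)
    (hκ : ∀ S : Set E3, (∀ x ∈ S, ∀ y ∈ S, x ≠ y → δ ≤ dist x y) → κ ((Measure.count : Measure E3).restrict S) = (Measure.count : Measure E3).restrict S) :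
    {p : Measure E3 × E3 | HostLikeAt δ τ 𝓐 p.1 p.2} =
      Prod.fst ⁻¹' {μ : Measure E3 | ∀ n : ℕ, ∀ q : ℚ, (q : ℝ) < δ / 2 → μ (ball (denseSeq E3 n) q) = 0 ∨ μ (ball (denseSeq E3 n) q) = 1} ∩
      (fun p : Measure E3 × E3 => (κ p.1).map fun x => x - p.2) ⁻¹' ({ν : Measure E3 | IsRootedHardCore δ ν} ∩ ⋃ p ∈ 𝓐, coherentOn p.1 τ p.2) := by
  ext ⟨μ, y⟩
  simp only [mem_setOf_eq, mem_inter_iff, mem_preimage, HostLikeAt, mem_iUnion, exists_prop]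
  constructor
  · rintro ⟨hhc, hcoh⟩
    have hb := ballCondition_of_isRootedHardCore_map_sub hhc
    obtain ⟨S, hsep, rfl⟩ := exists_eq_count_restrict_of_isRootedHardCore_map_sub hδ hhc
    rw [hκ S hsep]
    exact ⟨hb, hhc, hcoh⟩
  · rintro ⟨hb, hhc, hcoh⟩
    obtain ⟨S, hsep, rfl⟩ := (ballCondition_iff_exists_count_restrict hδ _).mp hb
    rw [hκ S hsep] at hhc hcoh
    exact ⟨hhc, hcoh⟩

/-- ★★ **JOINT MEASURABILITY OF THE MARK** (door clause `hmeas` of (334)): for `δ > 0` and a countable atlas with measurable windows,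
`{(μ, y) | HostLikeAt δ τ 𝓐 μ y}` is measurable in `Measure E3 × E3`. [folklore] -/
theorem measurableSet_hostLikeAt (hδ : 0 < δ) (h𝓐 : 𝓐.Countable) (hW : ∀ p ∈ 𝓐, MeasurableSet p.2) :
    MeasurableSet {p : Measure E3 × E3 | HostLikeAt δ τ 𝓐 p.1 p.2} := by
  obtain ⟨κ, hκs, hκ⟩ := exists_kernel_eq_count_restrict hδ
  rw [setOf_hostLikeAt_eq hδ κ hκ]
  exact (measurable_fst (measurableSet_setOf_ballCondition δ)).inter ((measurable_kernel_map_sub κ) (measurableSet_target hδ h𝓐 hW))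

/-- The `μ`-section of the mark is a measurable set of points. -/
theorem measurableSet_hostLikeAt_section (hδ : 0 < δ) (h𝓐 : 𝓐.Countable) (hW : ∀ p ∈ 𝓐, MeasurableSet p.2) (μ : Measure E3) :
    MeasurableSet {y : E3 | HostLikeAt δ τ 𝓐 μ y} :=
  measurable_prodMk_left (measurableSet_hostLikeAt hδ h𝓐 hW)

/-! ## §3. The root of a coherent cell member is host-like -/

/-- **Coherence restricts**: from pattern `a` on window `W` to a sub-pattern `a' ⊆ a` on a sub-window `W' ⊆ W`, provided the balls of the dropped sites
miss `W'`. [folklore] -/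
theorem coherentOn_restrict {a a' : Finset E3} {W W' : Set E3} (ha : a' ⊆ a) (hW : W' ⊆ W)
    (hmiss : ∀ x ∈ a, x ∉ a' → Disjoint (closedBall x τ) W') {μ : Measure E3} (h : μ ∈ coherentOn a τ W) : μ ∈ coherentOn a' τ W' := by
  rw [mem_coherentOn_iff] at h ⊢
  refine ⟨fun x hx => h.1 x (ha hx), measure_mono_null ?_ h.2⟩
  intro q hq
  refine ⟨hW hq.1, fun hq' => hq.2 ?_⟩
  simp only [mem_iUnion, exists_prop] at hq' ⊢
  obtain ⟨x, hx, hqx⟩ := hq'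
  by_cases hxa' : x ∈ a'
  · exact ⟨x, hxa', hqx⟩
  · exact absurd hq.1 (Set.disjoint_left.mp (hmiss x hx hxa') hqx)


/-- ★ **(Z0) THE ROOT OF A COHERENT CELL MEMBER IS HOST-LIKE**: a rooted `δ`-hard-core `μ ∈ coherentOn a τ W` is marked at `0` as soon as the atlas
holds an entry `(a', W')` with `a' ⊆ a`, `W' ⊆ W` and the dropped sites' balls off `W'` (the `h0` of every booked A/H/Z row). [folklore] -/
theorem hostLikeAt_zero_of_coherentOn (hμ : IsRootedHardCore δ μ) {a : Finset E3} {W : Set E3} (hcoh : μ ∈ coherentOn a τ W)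
    {p : Finset E3 × Set E3} (hp : p ∈ 𝓐) (ha : p.1 ⊆ a) (hW : p.2 ⊆ W) (hmiss : ∀ x ∈ a, x ∉ p.1 → Disjoint (closedBall x τ) p.2) :
    HostLikeAt δ τ 𝓐 μ 0 :=
  (hostLikeAt_zero_iff μ).mpr ⟨hμ, p, hp, coherentOn_restrict ha hW hmiss hcoh⟩

/-- The same with the atlas entry literally `(a, W)`. [folklore] -/
theorem hostLikeAt_zero_of_mem (hμ : IsRootedHardCore δ μ) {a : Finset E3} {W : Set E3} (hp : (a, W) ∈ 𝓐) (hcoh : μ ∈ coherentOn a τ W) :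
    HostLikeAt δ τ 𝓐 μ 0 :=
  (hostLikeAt_zero_iff μ).mpr ⟨hμ, (a, W), hp, hcoh⟩

/-! ## §4. The D-facing cell clause -/

/-- The D-facing zone of radius `R` beyond the plane `⟪q, n⟫ = s` (STRICT side, complementary to the closed `haloWindow`). -/
def dZone (R : ℝ) (n : E3) (s : ℝ) : Set E3 := {q | ‖q‖ ≤ R ∧ s < ⟪q, n⟫}

/-- The zone is measurable (closed ∩ open). -/
theorem measurableSet_dZone (R : ℝ) (n : E3) (s : ℝ) : MeasurableSet (dZone R n s) := by
  have h1 : MeasurableSet {q : E3 | ‖q‖ ≤ R} := measurableSet_le continuous_norm.measurable measurable_const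
  have h2 : Measurable fun q : E3 => ⟪q, n⟫ := (continuous_id.inner continuous_const).measurable
  exact h1.inter (measurableSet_lt measurable_const h2)

/-- ★ **THE D-FACING CELL CLAUSE** for a mark `Hm`: rooted `δ`-hard-core configurations with NO marked atom in the zone. -/
def DFacing (δ : ℝ) (Hm : Measure E3 → E3 → Prop) (R : ℝ) (n : E3) (s : ℝ) : Set (Measure E3) :=
  {μ | IsRootedHardCore δ μ ∧ μ {q | q ∈ dZone R n s ∧ Hm μ q} = 0}

variable {Hm : Measure E3 → E3 → Prop} {R s : ℝ} {n : E3}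

/-- The marked part of the zone, as a subset of `Measure E3 × E3`, is measurable for a jointly measurable mark. -/
theorem measurableSet_zone_mark (hmeas : MeasurableSet {p : Measure E3 × E3 | Hm p.1 p.2}) (R : ℝ) (n : E3) (s : ℝ) :
    MeasurableSet {p : Measure E3 × E3 | p.2 ∈ dZone R n s ∧ Hm p.1 p.2} :=
  (measurable_snd (measurableSet_dZone R n s)).inter hmeas

/-- ★ **THE D-FACING CLAUSE IS A MEASURABLE SET OF CONFIGURATIONS** (the extra factor of `hKZ`), for any jointly measurable mark and `δ > 0`. [folklore] -/
theorem measurableSet_dFacing (hδ : 0 < δ) (hmeas : MeasurableSet {p : Measure E3 × E3 | Hm p.1 p.2}) (R : ℝ) (n : E3) (s : ℝ) :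
    MeasurableSet (DFacing δ Hm R n s) := by
  obtain ⟨κ, hκs, hκ⟩ := exists_kernel_eq_count_restrict hδ
  have hf : Measurable fun μ : Measure E3 => κ μ (Prod.mk μ ⁻¹' {p : Measure E3 × E3 | p.2 ∈ dZone R n s ∧ Hm p.1 p.2}) :=
    Kernel.measurable_kernel_prodMk_left (measurableSet_zone_mark hmeas R n s)
  have heq : DFacing δ Hm R n s = {μ | IsRootedHardCore δ μ} ∩
      (fun μ : Measure E3 => κ μ (Prod.mk μ ⁻¹' {p : Measure E3 × E3 | p.2 ∈ dZone R n s ∧ Hm p.1 p.2})) ⁻¹' {0} := by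
    ext μ
    simp only [DFacing, mem_setOf_eq, mem_inter_iff, mem_preimage, mem_singleton_iff]
    constructor
    · rintro ⟨hμ, h0⟩
      obtain ⟨S, h0S, hsep, rfl⟩ := hμ
      rw [hκ S hsep]
      exact ⟨⟨S, h0S, hsep, rfl⟩, h0⟩
    · rintro ⟨hμ, h0⟩
      obtain ⟨S, h0S, hsep, rfl⟩ := hμ
      rw [hκ S hsep] at h0
      exact ⟨⟨S, h0S, hsep, rfl⟩, h0⟩
  rw [heq]
  exact (measurableSet_setOf_isRootedHardCore hδ).inter (hf (measurableSet_singleton 0))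

/-- Members of the clause are rooted hard-core. -/
theorem isRootedHardCore_of_mem_dFacing (h : μ ∈ DFacing δ Hm R n s) : IsRootedHardCore δ μ := h.1

/-- ★ **THE PLANE FORM** hand-1's `zoneFloor₁` consumes (`hD`): in the clause, no atom of the zone is marked. [folklore] -/
theorem dFacing_pointwise (hδ : 0 < δ) (h : μ ∈ DFacing δ Hm R n s) : ∀ q : E3, μ {q} ≠ 0 → ‖q‖ ≤ R → s < ⟪q, n⟫ → ¬ Hm μ q := by
  obtain ⟨⟨S, -, hsep, hS⟩, h0⟩ := h
  subst hS
  intro q hq hqR hqs hm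
  have hqS : q ∈ S := (count_restrict_singleton_ne_zero_iff S q).mp hq
  rw [Measure.restrict_apply' (isClosed_of_separated hδ hsep).measurableSet, Measure.count_eq_zero_iff] at h0
  have hmem : q ∈ {q : E3 | q ∈ dZone R n s ∧ Hm ((Measure.count : Measure E3).restrict S) q} ∩ S := ⟨⟨⟨hqR, hqs⟩, hm⟩, hqS⟩
  rw [h0] at hmem
  exact hmem

/-- Conversely the plane form puts a rooted hard-core configuration in the clause. [folklore] -/
theorem mem_dFacing_of_pointwise (hδ : 0 < δ) (hμ : IsRootedHardCore δ μ) (h : ∀ q : E3, μ {q} ≠ 0 → ‖q‖ ≤ R → s < ⟪q, n⟫ → ¬ Hm μ q) :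
    μ ∈ DFacing δ Hm R n s := by
  refine ⟨hμ, ?_⟩
  obtain ⟨S, -, hsep, hS⟩ := hμ
  subst hS
  rw [Measure.restrict_apply' (isClosed_of_separated hδ hsep).measurableSet, Measure.count_eq_zero_iff]
  exact Set.eq_empty_of_forall_notMem fun q hq => h q ((count_restrict_singleton_ne_zero_iff S q).mpr hq.2) hq.1.1.1 hq.1.1.2 hq.1.2

/-- Membership, unfolded to the plane form. [folklore] -/
theorem mem_dFacing_iff (hδ : 0 < δ) : μ ∈ DFacing δ Hm R n s ↔ IsRootedHardCore δ μ ∧ ∀ q : E3, μ {q} ≠ 0 → ‖q‖ ≤ R → s < ⟪q, n⟫ → ¬ Hm μ q :=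
  ⟨fun h => ⟨h.1, dFacing_pointwise hδ h⟩, fun h => mem_dFacing_of_pointwise hδ h.1 h.2⟩

/-- The clause only shrinks when the mark grows (a bigger atlas certifies fewer D-facing roots — sound either way). -/
theorem dFacing_anti {Hm Hm' : Measure E3 → E3 → Prop} (hle : ∀ μ q, Hm μ q → Hm' μ q) : DFacing δ Hm' R n s ⊆ DFacing δ Hm R n s := by
  intro μ h
  refine ⟨h.1, measure_mono_null ?_ h.2⟩
  intro q hq
  exact ⟨hq.1, hle μ q hq.2⟩

/-! ## §5. The programme's lines with the mark plugged in -/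

/-- Door clause `hG` with the mark of record: the zone pull kernel is jointly measurable. -/
theorem measurable_zonePull_hostLikeAt (hδ : 0 < δ) (h𝓐 : 𝓐.Countable) (hW : ∀ p ∈ 𝓐, MeasurableSet p.2) (R : ℝ) :
    Measurable (Function.uncurry (zonePull (HostLikeAt δ τ 𝓐) R)) :=
  measurable_zonePull (measurableSet_hostLikeAt hδ h𝓐 hW)

/-- ★ (K2) **A/H ROW FLOORS TRANSPORT VERBATIM** under the mark of record: at a rooted hard-core member of a coherent cell whose root pattern is in the
atlas, `c + m ≤ rootEnergy V μ` gives `c + m ≤ rootEnergy V μ + net 0 (zonePull (HostLikeAt δ τ 𝓐) R) μ`. [folklore] -/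
theorem floor_add_net_hostLike_of_floor (hμ : IsRootedHardCore δ μ) {a : Finset E3} {W : Set E3} (hcoh : μ ∈ coherentOn a τ W)
    {p : Finset E3 × Set E3} (hp : p ∈ 𝓐) (ha : p.1 ⊆ a) (hW : p.2 ⊆ W) (hmiss : ∀ x ∈ a, x ∉ p.1 → Disjoint (closedBall x τ) p.2)
    {R : ℝ} {V : ℝ → ℝ} {c m : ℝ} (h : c + m ≤ rootEnergy V μ) : c + m ≤ rootEnergy V μ + net 0 (zonePull (HostLikeAt δ τ 𝓐) R) μ :=
  floor_add_net_of_floor (hostLikeAt_hshift δ τ 𝓐) (hostLikeAt_zero_of_coherentOn hμ hcoh hp ha hW hmiss) h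

/-- (K2, with income) the Z-row reading under the mark of record. [folklore] -/
theorem floor_add_net_hostLike_of_floor_outflow (h0 : HostLikeAt δ τ 𝓐 μ 0) {R : ℝ} {V : ℝ → ℝ} {c m : ℝ}
    (h : c + m ≤ rootEnergy V μ + (∫⁻ y, zonePull (HostLikeAt δ τ 𝓐) R μ y ∂μ).toReal) :
    c + m ≤ rootEnergy V μ + net 0 (zonePull (HostLikeAt δ τ 𝓐) R) μ :=
  floor_add_net_of_floor_outflow (hostLikeAt_hshift δ τ 𝓐) h0 h

/-- ★★ **THE ATLAS DOOR WITH THE MARK OF RECORD** ((334) at `Hm := HostLikeAt δ τ 𝓐`, pull radius `8`): for `δ > 0` and a countable atlas with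
measurable windows, a finite list of measurable row cells with transported floors and the transported residual inequality give the route decl. [new: junction] -/
theorem aperiodicFrustratedLawGap_of_hostLikeAtlas (hδ : 0 < δ) (h𝓐 : 𝓐.Countable) (hW : ∀ p ∈ 𝓐, MeasurableSet p.2)
    (n : ℕ) (K : ℕ → Set (Measure E3)) (hK : ∀ i, MeasurableSet (K i)) (mK : ℕ → ℝ)
    (hfloor : ∀ i < n, ∀ μ : MeasureTheory.Measure (EuclideanSpace ℝ (Fin 3)), Literature.Probability.Process.IsRootedHardCore (7 / 10) μ →
      (∀ p : EuclideanSpace ℝ (Fin 3), μ {p} ≠ 0 → ∀ y : EuclideanSpace ℝ (Fin 3), (∀ q : EuclideanSpace ℝ (Fin 3), μ {q} ≠ 0 → q ≠ p → y ≠ q) → ∑' q : {q : EuclideanSpace ℝ (Fin 3) // μ {q} ≠ 0 ∧ q ≠ p}, Literature.MathematicalPhysics.StatisticalMechanics.lennardJones (dist p (q : EuclideanSpace ℝ (Fin 3))) ≤ ∑' q : {q : EuclideanSpace ℝ (Fin 3) // μ {q} ≠ 0 ∧ q ≠ p}, Literature.MathematicalPhysics.StatisticalMechanics.lennardJones (dist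 y (q : EuclideanSpace ℝ (Fin 3)))) → μ ∈ K i →
      (⨅ Q : Literature.MathematicalPhysics.StatisticalMechanics.PeriodicConfiguration 3, Q.energyPerParticle Literature.MathematicalPhysics.StatisticalMechanics.lennardJones) + mK i ≤ Literature.MathematicalPhysics.StatisticalMechanics.rootEnergy Literature.MathematicalPhysics.StatisticalMechanics.lennardJones μ + net 0 (zonePull (HostLikeAt δ τ 𝓐) 8) μ)
    (hres : ResidualCoreDeficitT n K mK 0 (zonePull (HostLikeAt δ τ 𝓐) 8)) :
    Summit.AtomisticToContinuum.Crystallization.Theses.FrustratedLawDichotomy.AperiodicFrustratedLawGap :=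
  aperiodicFrustratedLawGap_of_atlasPull (HostLikeAt δ τ 𝓐) (measurableSet_hostLikeAt hδ h𝓐 hW) n K hK mK hfloor hres

end Summit.AtomisticToContinuum.Crystallization.Theorems.FrustratedLawDichotomyZoneKernel

end
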